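import Summits.BirchSwinnertonDyer.Uniform.U2.TwistTamagawaTwoAdic
import Literature.NumberTheory.EllipticCurves.LocalTorsionMultiplicativeProofs
import Literature.NumberTheory.EllipticCurves.QuadraticTwistLocalPolynomialProofs
import Literature.NumberTheory.DiophantineGeometry.LocalReductionProofs
import HarnessLib

/-!
# Track U2 (cell `bsd-uniform`, seat u2-p1): the `2`-adic Tamagawa balance `hc` WITHOUT the
# «all bad primes split» restriction — odd-`ord` multiplicative primes inert in `ℚ(√d)` are harmless

HONEST FRAMING (cell `bsd-uniform`, HOME run/shared/lean/pub/bsd-uniform/): local arithmetic of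
Tamagawa numbers under quadratic twists; no claim about BSD beyond the displayed identity, nothing
booked, no census number moves, no per-curve certificate is counted as a uniform theorem. THIS FILE
closes the complementary case of HOME/RESIDUE.md **R-A7** left by `TwistTamagawaTwoAdic.lean`
(p512789): there the balance `ord₂ ∏ c_ℓ(E^{(d)}) = ord₂ ∏ c_ℓ(E)` needed EVERY odd bad prime of `E`
to split in `ℚ(√d)` (`hsplit`); here the hypothesis is weakened to Mazur–Rubin's own (Prop. 3.3 /
Cor. 3.4 (ii), the binders `hadd` / `hmev` of every U2 head): the odd ADDITIVE primes and the
EVEN-`ord_ℓ(Δ)` MULTIPLICATIVE primes split — the ODD-`ord_ℓ(Δ)` multiplicative primes are free.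

THE NEW INGREDIENT (Tate's algorithm, type `Iₙ`): at a prime `ℓ` of multiplicative reduction with
`n = ord_ℓ(Δ_min)` ODD, `c_ℓ = n` (split) or `c_ℓ = 1` (non-split; it would be `2` for `n` even) —
ODD either way (Silverman *ATAEC* Cor. IV.9.2(d), IV.9.4 Step 2; tree theorems
`localTamagawaNumber_eq_ordMinimalDiscriminant_of_hasSplitMultiplicativeReductionAt`,
`localTamagawaNumber_of_hasNonsplitMultiplicativeReductionAt_holds`). For `ℓ ∤ 2d` the twist
`E^{(d)}` is again multiplicative at `ℓ` with the same `ord_ℓ(Δ_min)` parity (the twist by an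
`ℓ`-adic unit of a minimal equation is minimal with the same reduction type,
`isMinimal_quadraticTwist` / `hasMultiplicativeReduction_quadraticTwist_iff`; `Δ ↦ u⁻¹² d⁶ Δ` keeps
the parity of `ord_ℓ`), so `c_ℓ(E^{(d)})` is odd too and `ord₂ c_ℓ(E^{(d)}) = 0 = ord₂ c_ℓ(E)`
whether or not `ℓ` splits in `ℚ(√d)`.

## Contents (theorems only; no `def`, no named fact)
* `odd_localTamagawaNumber_padic_of_mult_of_odd` — multiplicative at `p` with `ord_p(Δ_min)` odd ⟹
  `c_p` odd (globally minimal `W`).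
* `hasMultiplicativeReductionAtPrime_of_twist_of_not_dvd` — `p` odd, `p ∤ d`: `E` multiplicative at
  `p` ⟹ `E^{(d)}` (any model) multiplicative at `p`.
* `even_padicValRat_Δ_iff_of_twist` — the parity of `ord_p Δ` is the same for any model of `E^{(d)}`
  and `E`.
* `padicValNat_two_localTamagawaNumber_twist_eq'` — prime by prime, under the WEAKENED hypothesis
  «`(d/ℓ) = 1` OR (`ℓ` multiplicative with `ord_ℓ(Δ)` odd)» at the odd bad `ℓ`.
* **`padicValNat_two_tamagawaProduct_twist_eq_of_mazurRubin`** — `ord₂ ∏ c_ℓ(E^{(d)}) = ord₂ ∏ c_ℓ(E)`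
  under exactly the Mazur–Rubin binders `hadd` / `hmev` of the U2 heads (+ `d ≡ 1 (mod 8)`, `hS`).

References: Silverman *ATAEC* (1994) Cor. IV.9.2(d), IV.9.4 Step 2 [SilvermanATAEC1994];
Silverman *AEC* 2nd ed. (2009) VII.1 Prop. 1.3, VII.5 Prop. 5.1, VII.6, X.5 Cor. 5.4 [SilvermanAEC2009];
Mazur–Rubin 2010 Prop. 3.3, Lemma 2.10 [MazurRubin2010]; HOME/RESIDUE.md R-A7, T4-PROOF §3 L3.
-/

set_option autoImplicit false

noncomputable section

open scoped Classical

open IsDedekindDomain NumberField Rat.HeightOneSpectrum WeierstrassCurve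
  Literature.NumberTheory.EllipticCurves

namespace Summit.BirchSwinnertonDyer.Uniform.U2

/-! ## §1 Multiplicative with `ord_p(Δ_min)` odd ⟹ `c_p` odd -/

/-- **Type `Iₙ` with `n` odd has odd Tamagawa number.** For a globally minimal `W / ℚ` with
multiplicative reduction at `p` and `n = ord_p(Δ_min(W))` odd: `c_p = n` if the reduction is split
(Kodaira–Néron, Silverman *ATAEC* Cor. IV.9.2(d)) and `c_p = 1` if it is non-split (Tate's algorithm
Step 2, `c = 2` only for `n` even, *ATAEC* IV.9.4) — odd in both cases. The tree's place-indexed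
values are moved to Mathlib's `ℚ_[p]` by `localTamagawaNumber_padic_eq_holds` and
`ordMinimalDiscriminant_eq_padicValInt`.
[cite: SilvermanATAEC1994, Cor. IV.9.2(d) and IV.9.4 Step 2 (PDF pp. 340, 344)] -/
theorem odd_localTamagawaNumber_padic_of_mult_of_odd (W : WeierstrassCurve ℚ) [W.IsElliptic]
    [W.IsGloballyMinimal] (p : ℕ) [hp : Fact p.Prime] (hmult : W.HasMultiplicativeReductionAtPrime p)
    (hodd : Odd (padicValInt p W.minimalDiscriminantInt)) :
    Odd ((W.baseChange ℚ_[p]).localTamagawaNumber ℤ_[p]) := by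
  -- the place of `𝓞 ℚ` over `p`
  set v : HeightOneSpectrum (𝓞 ℚ) := (primesEquiv (R := 𝓞 ℚ)).symm ⟨p, hp.out⟩ with hvdef
  have hv : primesEquiv v = ⟨p, hp.out⟩ := Equiv.apply_symm_apply _ _
  have hvp : (primesEquiv v : ℕ) = p := congrArg Subtype.val hv
  have hmultv : W.HasMultiplicativeReductionAt v := by
    have key : ∀ q : Nat.Primes, primesEquiv v = q →
        (haveI := Fact.mk q.2; W.HasMultiplicativeReductionAtPrime (q : ℕ)) →
          W.HasMultiplicativeReductionAt v := by
      rintro q rfl h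
      exact (hasMultiplicativeReductionAtPrime_iff_hasMultiplicativeReductionAt_ringOfIntegers W v).mp h
    exact key ⟨p, hp.out⟩ hv hmult
  haveI : Finite (IsLocalRing.ResidueField (v.adicCompletionIntegers ℚ)) :=
    HeightOneSpectrum.finite_residueField_adicCompletionIntegers ℚ v
  rw [localTamagawaNumber_padic_eq_holds W v p hvp]
  by_cases hs : W.HasSplitMultiplicativeReductionAt v
  · -- split: `c = ord_v(Δ_min) = v_p(Δ_min)`, odd
    rw [localTamagawaNumber_eq_ordMinimalDiscriminant_of_hasSplitMultiplicativeReductionAt v W hs,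
      LocalTorsionMult.ordMinimalDiscriminant_eq_padicValInt W v hvp]
    exact hodd
  · -- non-split: `c = 1` since `ord_v(Δ_min)` is odd
    rw [localTamagawaNumber_of_hasNonsplitMultiplicativeReductionAt_holds v W hmultv hs,
      LocalTorsionMult.ordMinimalDiscriminant_eq_padicValInt W v hvp,
      if_neg (Nat.not_even_iff_odd.mpr hodd)]
    exact odd_one

/-! ## §2 The twist by an `ℓ`-adic unit stays multiplicative, with the same parity of `ord_ℓ Δ` -/

/-- An integer prime to `p` is a unit of `ℤ_p`. [folklore] -/
private theorem isUnit_intCast_padicInt {p : ℕ} [Fact p.Prime] {z : ℤ} (h : ¬ (p : ℤ) ∣ z) :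
    IsUnit (z : ℤ_[p]) := by
  rw [PadicInt.isUnit_iff]
  exact le_antisymm (PadicInt.norm_le_one _)
    (not_lt.mp fun hlt => h ((PadicInt.norm_int_lt_one_iff_dvd z).mp hlt))

/-- **`E^{(d)}` is multiplicative at an odd prime `p ∤ d` where `E` is.** For `W / ℚ` globally
minimal with multiplicative reduction at an odd prime `p` not dividing `d ≠ 0`, every model `W₁` of
`E^{(d)}` has multiplicative reduction at `p`: `W ⊗ ℚ_p` is `ℤ_p`-minimal, `d ∈ ℤ_pˣ`, so the twist
model `(W ⊗ ℚ_p)^{(d)}` is `ℤ_p`-minimal with the same `v(Δ)`, `v(c₄)` (`isMinimal_quadraticTwist`,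
`hasMultiplicativeReduction_quadraticTwist_iff`), and the reduction type of the chosen minimal model of
`W₁ ⊗ ℚ_p ≅ (W ⊗ ℚ_p)^{(d)}` is that of any `ℚ_p`-isomorphic minimal equation
(`hasMultiplicativeReduction_iff_of_isMinimal_of_eq_smul`, Silverman VII.1.3(b), VII.5.1(b)).
[cite: SilvermanAEC2009, VII.5 Prop. 5.1(b) and VII.1 Prop. 1.3(b)] -/
theorem hasMultiplicativeReductionAtPrime_of_twist_of_not_dvd (W : WeierstrassCurve ℚ) [W.IsElliptic]
    [W.IsGloballyMinimal] (p : ℕ) [hp : Fact p.Prime] (hp2 : p ≠ 2) {d : ℤ} (hd0 : d ≠ 0)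
    (hpd : ¬ (p : ℤ) ∣ d) {W₁ : WeierstrassCurve ℚ} [W₁.IsElliptic]
    (h₁ : ∃ C : VariableChange ℚ, C • W₁ = W.quadraticTwist (d : ℚ))
    (hmult : W.HasMultiplicativeReductionAtPrime p) : W₁.HasMultiplicativeReductionAtPrime p := by
  have hpP : p.Prime := hp.out
  have hdQ : (d : ℚ) ≠ 0 := by exact_mod_cast hd0
  -- `X = W ⊗ ℚ_p` is `ℤ_p`-minimal; `d`, `2` are units of `ℤ_p`
  set X : WeierstrassCurve ℚ_[p] := W.baseChange ℚ_[p] with hX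
  haveI : X.IsElliptic := inferInstanceAs (W.map (algebraMap ℚ ℚ_[p])).IsElliptic
  haveI hXmin : X.IsMinimal ℤ_[p] := isMinimal_map_padic_of_isGloballyMinimal W p
  have hdu : IsUnit ((d : ℤ) : ℤ_[p]) := isUnit_intCast_padicInt hpd
  have h2 : IsUnit (2 : ℤ_[p]) := by
    have h := isUnit_intCast_padicInt (p := p) (z := 2) (fun h => hp2
      ((Nat.prime_dvd_prime_iff_eq hpP Nat.prime_two).mp (by exact_mod_cast h)))
    simpa using h
  haveI : NeZero (2 : ℚ_[p]) := ⟨two_ne_zero⟩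
  set u : ℤ_[p]ˣ := hdu.unit with hu
  have hud : algebraMap ℤ_[p] ℚ_[p] (u : ℤ_[p]) = algebraMap ℚ ℚ_[p] (d : ℚ) := by
    rw [hu, IsUnit.unit_spec, map_intCast, map_intCast]
  -- the twist model `Y = X^{(d)} = (W^{(d)}) ⊗ ℚ_p` is minimal and multiplicative
  set Y : WeierstrassCurve ℚ_[p] := X.quadraticTwist (algebraMap ℤ_[p] ℚ_[p] (u : ℤ_[p])) with hY
  haveI hYmin : Y.IsMinimal ℤ_[p] := isMinimal_quadraticTwist ℤ_[p] X h2 u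
  have hXΔ : X.Δ ≠ 0 := X.isUnit_Δ.ne_zero
  have hXmult : X.HasMultiplicativeReduction ℤ_[p] :=
    (hasMultiplicativeReduction_iff_of_isMinimal_of_eq_smul ℤ_[p] (W₁ := X) (W₂ := X.minimal ℤ_[p])
      rfl hXΔ).mp hmult
  have hYmult : Y.HasMultiplicativeReduction ℤ_[p] :=
    (hasMultiplicativeReduction_quadraticTwist_iff (R := ℤ_[p]) (X := X) (d := u)).mpr hXmult
  have hYeq : Y = (W.quadraticTwist (d : ℚ)).baseChange ℚ_[p] := by
    rw [hY, hud, hX, WeierstrassCurve.baseChange, WeierstrassCurve.baseChange, map_quadraticTwist]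
  haveI : Y.IsElliptic := by
    rw [hYeq]
    haveI := W.isElliptic_quadraticTwist hdQ
    exact inferInstanceAs ((W.quadraticTwist (d : ℚ)).map (algebraMap ℚ ℚ_[p])).IsElliptic
  have hYΔ : Y.Δ ≠ 0 := Y.isUnit_Δ.ne_zero
  -- `W₁ ⊗ ℚ_p = D • Y`; its chosen minimal model is `(choose * D) • Y`
  obtain ⟨C, hC⟩ := h₁
  have hW₁ : W₁ = C⁻¹ • W.quadraticTwist (d : ℚ) := by rw [← hC, inv_smul_smul]
  have hD : W₁.baseChange ℚ_[p] = C⁻¹.map (algebraMap ℚ ℚ_[p]) • Y := by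
    rw [hW₁, WeierstrassCurve.VariableChange.baseChange_smul_eq (W.quadraticTwist (d : ℚ)) C⁻¹ ℚ_[p],
      hYeq]
  have hmin₁ : (W₁.baseChange ℚ_[p]).minimal ℤ_[p] =
      (((W₁.baseChange ℚ_[p]).exists_isMinimal ℤ_[p]).choose * C⁻¹.map (algebraMap ℚ ℚ_[p])) • Y := by
    rw [mul_smul, ← hD]; rfl
  unfold WeierstrassCurve.HasMultiplicativeReductionAtPrime
  exact (hasMultiplicativeReduction_iff_of_isMinimal_of_eq_smul ℤ_[p] hmin₁ hYΔ).mpr hYmult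

/-- **The parity of `ord_p Δ` is the same for `E` and any model of `E^{(d)}`**: if
`C • W₁ = W^{(d)}` then `Δ(W₁) = u¹² d⁶ Δ(W)`, so `ord_p Δ(W₁) ≡ ord_p Δ(W) (mod 2)` (any prime `p`,
any `d ≠ 0`). [cite: SilvermanAEC2009, III.1 Table 3.1 and X.5 (twist discriminant)] -/
theorem even_padicValRat_Δ_iff_of_twist (W W₁ : WeierstrassCurve ℚ) [W.IsElliptic] {d : ℚ}
    (hd : d ≠ 0) (h₁ : ∃ C : VariableChange ℚ, C • W₁ = W.quadraticTwist d) (p : ℕ) [Fact p.Prime] :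
    Even (padicValRat p W₁.Δ) ↔ Even (padicValRat p W.Δ) := by
  obtain ⟨C, hC⟩ := h₁
  have hW₁ : W₁ = C⁻¹ • W.quadraticTwist d := by rw [← hC, inv_smul_smul]
  have hΔ : W₁.Δ = ((C⁻¹.u⁻¹ : ℚˣ) : ℚ) ^ 12 * (d ^ 6 * W.Δ) := by
    rw [hW₁, variableChange_Δ, quadraticTwist_Δ]
  have hu0 : ((C⁻¹.u⁻¹ : ℚˣ) : ℚ) ≠ 0 := (C⁻¹.u⁻¹).ne_zero
  have hWΔ : W.Δ ≠ 0 := W.isUnit_Δ.ne_zero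
  rw [hΔ, padicValRat.mul (pow_ne_zero _ hu0) (mul_ne_zero (pow_ne_zero _ hd) hWΔ),
    padicValRat.mul (pow_ne_zero _ hd) hWΔ, padicValRat.pow, padicValRat.pow, Int.even_add,
    Int.even_add]
  have h12 : Even (((12 : ℕ) : ℤ) * padicValRat p ((C⁻¹.u⁻¹ : ℚˣ) : ℚ)) :=
    ⟨6 * padicValRat p ((C⁻¹.u⁻¹ : ℚˣ) : ℚ), by push_cast; ring⟩
  have h6 : Even (((6 : ℕ) : ℤ) * padicValRat p d) := ⟨3 * padicValRat p d, by push_cast; ring⟩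
  exact ⟨fun h => (h.mp h12).mp h6, fun h => ⟨fun _ => ⟨fun _ => h, fun _ => h6⟩, fun _ => h12⟩⟩

/-! ## §3 Prime by prime, under the weakened hypothesis -/

/-- **`ord₂ c_ℓ(E^{(d)}) = ord₂ c_ℓ(E)` at every prime `ℓ`**, for the a_q-odd class, under: at every
odd bad prime `ℓ` of `E`, EITHER `(d/ℓ) = 1` OR `E` is multiplicative at `ℓ` with `ord_ℓ(Δ)` odd.
Cases as in `padicValNat_two_localTamagawaNumber_twist_eq` (p512789), plus the new one: `ℓ`
multiplicative of odd `ord`, `ℓ ∤ 2d` — then `c_ℓ(E)` and `c_ℓ(E^{(d)})` are both ODD (§1, §2), so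
both `ord₂` vanish. [cite: SilvermanATAEC1994, Cor. IV.9.2(d) and IV.9.4 Step 2]
[cite: SilvermanAEC2009, VII.6 and X.5 Cor. 5.4] [cite: MazurRubin2010, Prop. 3.3 and Lemma 2.10 (ii)] -/
theorem padicValNat_two_localTamagawaNumber_twist_eq' (W : WeierstrassCurve ℚ) [W.IsElliptic]
    [W.IsGloballyMinimal] {d : ℤ} (hd8 : d % 8 = 1)
    (hS : ∀ (q : ℕ), q.Prime → (q : ℤ) ∣ d →
      ¬ (q : ℤ) ∣ minimalDiscriminantInt W ∧ Odd (W.frobeniusTrace q))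
    {W₁ : WeierstrassCurve ℚ} [W₁.IsElliptic]
    (h₁ : ∃ C : VariableChange ℚ, C • W₁ = W.quadraticTwist (d : ℚ)) (ℓ : ℕ) [Fact ℓ.Prime]
    (hℓ : ℓ ∣ W.conductorNorm ℤ → ℓ ≠ 2 →
      jacobiSym d ℓ = 1 ∨ (W.HasMultiplicativeReductionAtPrime ℓ ∧ Odd (padicValRat ℓ W.Δ))) :
    padicValNat 2 ((W₁.baseChange ℚ_[ℓ]).localTamagawaNumber ℤ_[ℓ]) =
      padicValNat 2 ((W.baseChange ℚ_[ℓ]).localTamagawaNumber ℤ_[ℓ]) := by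
  have hℓP : ℓ.Prime := Fact.out
  have hd0 : d ≠ 0 := by rintro rfl; norm_num at hd8
  have hdQ : (d : ℚ) ≠ 0 := by exact_mod_cast hd0
  obtain ⟨C, hC⟩ := h₁
  have hWd : C⁻¹ • W.quadraticTwist (d : ℚ) = W₁ := by rw [← hC, inv_smul_smul]
  haveI : (W.baseChange ℚ_[ℓ]).IsElliptic := inferInstanceAs (W.map (algebraMap ℚ ℚ_[ℓ])).IsElliptic
  haveI : (W₁.baseChange ℚ_[ℓ]).IsElliptic := inferInstanceAs (W₁.map (algebraMap ℚ ℚ_[ℓ])).IsElliptic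
  haveI : (W.quadraticTwist (d : ℚ)).IsElliptic := W.isElliptic_quadraticTwist hdQ
  by_cases hℓN : ℓ ∣ W.conductorNorm ℤ
  · by_cases hℓ2 : ℓ = 2
    · -- `ℓ = 2 ∣ N`: `d ≡ 1 (mod 8)` is a square in `ℚ₂`, the two curves are `ℚ₂`-isomorphic
      subst hℓ2
      have hsq : IsSquare ((d : ℤ) : ℚ_[2]) := KramerLocal.padicTwo_isSquare_intCast (by omega)
      obtain ⟨θ, hθ⟩ := hsq
      have hθ0 : θ ≠ 0 := by
        rintro rfl
        rw [mul_zero] at hθ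
        exact hd0 (by exact_mod_cast hθ)
      obtain ⟨C', hC'⟩ := (W.baseChange ℚ_[2]).exists_variableChange_smul_eq_quadraticTwist_sq hθ0
      have h1 : (W.quadraticTwist (d : ℚ)).baseChange ℚ_[2] = C' • W.baseChange ℚ_[2] := by
        rw [hC', WeierstrassCurve.baseChange, WeierstrassCurve.baseChange, map_quadraticTwist, sq,
          map_intCast, hθ]
      have hYX : W₁.baseChange ℚ_[2] = (C⁻¹.map (algebraMap ℚ ℚ_[2]) * C') • W.baseChange ℚ_[2] := by
        rw [← hWd, WeierstrassCurve.VariableChange.baseChange_smul_eq (W.quadraticTwist (d : ℚ)) C⁻¹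
          ℚ_[2], h1, mul_smul]
      rw [hYX, localTamagawaNumber_variableChange_holds ℤ_[2] (W.baseChange ℚ_[2])
        (C⁻¹.map (algebraMap ℚ ℚ_[2]) * C')]
    · rcases hℓ hℓN hℓ2 with hj | ⟨hmult, hodd⟩
      · -- `(d/ℓ) = 1`: `d` is a square in `ℚ_ℓ`, the two curves are `ℚ_ℓ`-isomorphic
        obtain ⟨θ, hθ⟩ := padic_isSquare_of_jacobiSym_eq_one hℓ2 hj
        have hθ0 : θ ≠ 0 := by
          rintro rfl
          rw [mul_zero] at hθ
          exact hd0 (by exact_mod_cast hθ)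
        obtain ⟨C', hC'⟩ := (W.baseChange ℚ_[ℓ]).exists_variableChange_smul_eq_quadraticTwist_sq hθ0
        have h1 : (W.quadraticTwist (d : ℚ)).baseChange ℚ_[ℓ] = C' • W.baseChange ℚ_[ℓ] := by
          rw [hC', WeierstrassCurve.baseChange, WeierstrassCurve.baseChange, map_quadraticTwist, sq,
            map_intCast, hθ]
        have hYX : W₁.baseChange ℚ_[ℓ] =
            (C⁻¹.map (algebraMap ℚ ℚ_[ℓ]) * C') • W.baseChange ℚ_[ℓ] := by
          rw [← hWd, WeierstrassCurve.VariableChange.baseChange_smul_eq (W.quadraticTwist (d : ℚ))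
            C⁻¹ ℚ_[ℓ], h1, mul_smul]
        rw [hYX, localTamagawaNumber_variableChange_holds ℤ_[ℓ] (W.baseChange ℚ_[ℓ])
          (C⁻¹.map (algebraMap ℚ ℚ_[ℓ]) * C')]
      · -- NEW CASE: `ℓ` multiplicative with `ord_ℓ(Δ)` odd — both Tamagawa numbers are odd
        -- `ℓ ∤ d` (the primes of `d` are good)
        have hℓd : ¬ (ℓ : ℤ) ∣ d := fun h => by
          have hgood : W.HasGoodReductionAtPrime ℓ := hasGoodReductionAtPrime_of_not_dvd W ℓ (hS ℓ hℓP h).1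
          exact WeierstrassCurve.HasMultiplicativeReduction.not_hasGoodReduction (R := ℤ_[ℓ]) hmult hgood
        -- `c_ℓ(E)` odd
        have hoddW : Odd ((W.baseChange ℚ_[ℓ]).localTamagawaNumber ℤ_[ℓ]) := by
          refine odd_localTamagawaNumber_padic_of_mult_of_odd W ℓ hmult ?_
          rw [← cast_minimalDiscriminantInt W, padicValRat.of_int] at hodd
          exact (Int.odd_coe_nat _).mp hodd
        -- a globally minimal model of the twist, multiplicative at `ℓ` with `ord_ℓ(Δ)` odd
        obtain ⟨W₁', hW₁'e, hW₁'m, C₁, hC₁⟩ := exists_isGloballyMinimal_smul_eq_quadraticTwist W hdQ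
        haveI := hW₁'e
        haveI := hW₁'m
        have hmult' : W₁'.HasMultiplicativeReductionAtPrime ℓ :=
          hasMultiplicativeReductionAtPrime_of_twist_of_not_dvd W ℓ hℓ2 hd0 hℓd ⟨C₁, hC₁⟩ hmult
        have hodd' : Odd (padicValInt ℓ W₁'.minimalDiscriminantInt) := by
          have h := (even_padicValRat_Δ_iff_of_twist W W₁' hdQ ⟨C₁, hC₁⟩ ℓ).not.mpr
            (Int.not_even_iff_odd.mpr hodd)
          rw [← cast_minimalDiscriminantInt W₁', padicValRat.of_int] at h
          exact (Int.odd_coe_nat _).mp (Int.not_even_iff_odd.mp h)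
        have hoddW₁' : Odd ((W₁'.baseChange ℚ_[ℓ]).localTamagawaNumber ℤ_[ℓ]) :=
          odd_localTamagawaNumber_padic_of_mult_of_odd W₁' ℓ hmult' hodd'
        -- `W₁ ≅ W₁'` over `ℚ`, so `c_ℓ(W₁) = c_ℓ(W₁')`
        haveI : (W₁'.baseChange ℚ_[ℓ]).IsElliptic :=
          inferInstanceAs (W₁'.map (algebraMap ℚ ℚ_[ℓ])).IsElliptic
        have hW₁W₁' : W₁ = (C⁻¹ * C₁) • W₁' := by rw [mul_smul, hC₁, hWd]
        have hloc : (W₁.baseChange ℚ_[ℓ]).localTamagawaNumber ℤ_[ℓ] =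
            (W₁'.baseChange ℚ_[ℓ]).localTamagawaNumber ℤ_[ℓ] := by
          rw [hW₁W₁', WeierstrassCurve.VariableChange.baseChange_smul_eq W₁' (C⁻¹ * C₁) ℚ_[ℓ],
            localTamagawaNumber_variableChange_holds ℤ_[ℓ] (W₁'.baseChange ℚ_[ℓ])]
        rw [hloc, padicValNat.eq_zero_of_not_dvd (Nat.two_dvd_ne_zero.mpr (Nat.odd_iff.mp hoddW₁')),
          padicValNat.eq_zero_of_not_dvd (Nat.two_dvd_ne_zero.mpr (Nat.odd_iff.mp hoddW))]
  · -- `ℓ ∤ N`: `W` is good at `ℓ`, `c_ℓ(W) = 1` (verbatim from p512789)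
    have hgood : W.HasGoodReductionAtPrime ℓ := by
      by_contra h
      exact hℓN ((W.dvd_conductorNorm_iff_not_hasGoodReductionAtPrime ℓ).mpr h)
    have hcW : (W.baseChange ℚ_[ℓ]).localTamagawaNumber ℤ_[ℓ] = 1 := by
      haveI : ((W.baseChange ℚ_[ℓ]).minimal ℤ_[ℓ]).HasGoodReduction ℤ_[ℓ] := hgood
      exact localTamagawaNumber_eq_one_of_hasGoodReduction_holds ℤ_[ℓ] _
    rw [hcW, padicValNat_one_right]
    by_cases hℓd : (ℓ : ℤ) ∣ d
    · -- `ℓ = q ∣ d`: `E(ℚ_q)[2] = 0` (a_q odd) ⇒ `E^{(d)}(ℚ_q)[2] = 0` ⇒ `c_q(E^{(d)})` odd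
      have hℓ2 : ℓ ≠ 2 := by rintro rfl; have : (2 : ℤ) ∣ d := hℓd; omega
      obtain ⟨hℓΔ, hodd⟩ := hS ℓ hℓP hℓd
      have hE : ∀ Q : (W.baseChange ℚ_[ℓ]).toAffine.Point, 2 • Q = 0 → Q = 0 :=
        (forall_two_nsmul_eq_zero_iff_odd_frobeniusTrace W hℓ2 hℓΔ).mpr hodd
      obtain ⟨W₁', hW₁'e, hW₁'m, C₁, hC₁⟩ := exists_isGloballyMinimal_smul_eq_quadraticTwist W hdQ
      haveI := hW₁'e
      haveI := hW₁'m
      have hE' : ∀ Q : (W₁'.baseChange ℚ_[ℓ]).toAffine.Point, 2 • Q = 0 → Q = 0 :=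
        (TwoTorsionField.forall_two_nsmul_eq_zero_iff_of_twist W hdQ W₁' ⟨C₁, hC₁⟩).mp hE
      have hc₁odd := ((forall_two_nsmul_eq_zero_iff_odd_tamagawa_and_odd_frobeniusTrace W₁' ℓ
        hℓ2).mp hE').1
      haveI : (W₁'.baseChange ℚ_[ℓ]).IsElliptic :=
        inferInstanceAs (W₁'.map (algebraMap ℚ ℚ_[ℓ])).IsElliptic
      have hW₁W₁' : W₁ = (C⁻¹ * C₁) • W₁' := by rw [mul_smul, hC₁, hWd]
      have hloc : (W₁.baseChange ℚ_[ℓ]).localTamagawaNumber ℤ_[ℓ] =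
          (W₁'.baseChange ℚ_[ℓ]).localTamagawaNumber ℤ_[ℓ] := by
        rw [hW₁W₁', WeierstrassCurve.VariableChange.baseChange_smul_eq W₁' (C⁻¹ * C₁) ℚ_[ℓ],
          localTamagawaNumber_variableChange_holds ℤ_[ℓ] (W₁'.baseChange ℚ_[ℓ])]
      rw [hloc]
      exact padicValNat.eq_zero_of_not_dvd (Nat.two_dvd_ne_zero.mpr (Nat.odd_iff.mp hc₁odd))
    · -- `ℓ ∤ N d`: unramified twist, good reduction preserved, `c_ℓ(E^{(d)}) = 1`
      have h4 : d = 4 * (d / 4) + 1 := by omega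
      rw [Rank1Residual.X2.localTamagawaNumber_twist_of_not_dvd W ℓ h4 hℓd hgood C⁻¹ hWd,
        padicValNat_one_right]

/-! ## §4 The `2`-adic Tamagawa balance under Mazur–Rubin's own splitting conditions -/

/-- `ord_p` of a finite product of non-zero naturals is the sum of the `ord_p`. [folklore] -/
private theorem padicValNat_finset_prod₃ (p : ℕ) [Fact p.Prime] {ι : Type*} (s : Finset ι)
    (f : ι → ℕ) (hf : ∀ i ∈ s, f i ≠ 0) :
    padicValNat p (∏ i ∈ s, f i) = ∑ i ∈ s, padicValNat p (f i) := by
  induction s using Finset.induction_on with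
  | empty => simp
  | insert a s ha ih =>
    rw [Finset.prod_insert ha, Finset.sum_insert ha,
      padicValNat.mul (hf a (Finset.mem_insert_self a s))
        (Finset.prod_ne_zero_iff.mpr fun i hi => hf i (Finset.mem_insert_of_mem hi)),
      ih fun i hi => hf i (Finset.mem_insert_of_mem hi)]

/-- **`ord₂ ∏_ℓ c_ℓ(E^{(d)}) = ord₂ ∏_ℓ c_ℓ(E)` under MAZUR–RUBIN'S OWN splitting conditions** — the
per-twist-pair binder `hc` (HOME/RESIDUE.md R-A7, T4-PROOF L3) of the U2 end-to-end heads as a CLASS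
THEOREM on the WHOLE a_q-odd class of the heads: `W / ℚ` globally minimal elliptic, `d ≡ 1 (mod 8)`,
every prime `q ∣ d` good with `a_q` odd (`hS`), the odd ADDITIVE primes and the odd MULTIPLICATIVE
primes of EVEN `ord_ℓ(Δ)` split in `ℚ(√d)` (`hadd`, `hmev` — verbatim the binders of
`bsdp_two_of_genusTheory_oneH2`); `W₁` ANY model of `E^{(d)}`. The odd-`ord` multiplicative primes
need no splitting (§1–§3). [cite: SilvermanATAEC1994, Cor. IV.9.2(d) and IV.9.4 Step 2]
[cite: SilvermanAEC2009, VII.6 and X.5 Cor. 5.4] [cite: MazurRubin2010, Prop. 3.3 and Lemma 2.10 (ii)] -/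
theorem padicValNat_two_tamagawaProduct_twist_eq_of_mazurRubin (W : WeierstrassCurve ℚ)
    [W.IsElliptic] [W.IsGloballyMinimal] {d : ℤ} (hd8 : d % 8 = 1)
    (hS : ∀ (q : ℕ), q.Prime → (q : ℤ) ∣ d →
      ¬ (q : ℤ) ∣ minimalDiscriminantInt W ∧ Odd (W.frobeniusTrace q))
    (hadd : ∀ (p : ℕ) [Fact p.Prime], ¬ W.HasGoodReductionAtPrime p →
      ¬ W.HasMultiplicativeReductionAtPrime p → p ≠ 2 → jacobiSym d p = 1)
    (hmev : ∀ (p : ℕ) [Fact p.Prime], W.HasMultiplicativeReductionAtPrime p →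
      Even (padicValRat p W.Δ) → p ≠ 2 → jacobiSym d p = 1)
    {W₁ : WeierstrassCurve ℚ} [W₁.IsElliptic]
    (h₁ : ∃ C : VariableChange ℚ, C • W₁ = W.quadraticTwist (d : ℚ)) :
    padicValNat 2 W₁.tamagawaProduct = padicValNat 2 W.tamagawaProduct := by
  haveI : Fact (Nat.Prime 2) := ⟨Nat.prime_two⟩
  -- the per-prime hypothesis of §3 from `hadd` / `hmev`
  have hℓ : ∀ (ℓ : ℕ) [Fact ℓ.Prime], ℓ ∣ W.conductorNorm ℤ → ℓ ≠ 2 →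
      jacobiSym d ℓ = 1 ∨ (W.HasMultiplicativeReductionAtPrime ℓ ∧ Odd (padicValRat ℓ W.Δ)) := by
    intro ℓ _ hℓN hℓ2
    by_cases hm : W.HasMultiplicativeReductionAtPrime ℓ
    · by_cases he : Even (padicValRat ℓ W.Δ)
      · exact Or.inl (hmev ℓ hm he hℓ2)
      · exact Or.inr ⟨hm, Int.not_even_iff_odd.mp he⟩
    · exact Or.inl (hadd ℓ ((W.dvd_conductorNorm_iff_not_hasGoodReductionAtPrime ℓ).mp hℓN) hm hℓ2)
  have hfW : (W.badPlaces ℤ).Finite := W.finite_badPlaces_holds ℤ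
  have hfW₁ : (W₁.badPlaces ℤ).Finite := W₁.finite_badPlaces_holds ℤ
  set s : Finset (HeightOneSpectrum ℤ) := hfW.toFinset ∪ hfW₁.toFinset with hs
  have hsW : ∀ v, ¬ W.HasGoodReductionAt v → v ∈ s := fun v hv ↦
    Finset.mem_union_left _ (by rw [Set.Finite.mem_toFinset, mem_badPlaces_iff]; exact hv)
  have hsW₁ : ∀ v, ¬ W₁.HasGoodReductionAt v → v ∈ s := fun v hv ↦
    Finset.mem_union_right _ (by rw [Set.Finite.mem_toFinset, mem_badPlaces_iff]; exact hv)
  rw [tamagawaProduct_eq_prod W s hsW, tamagawaProduct_eq_prod W₁ s hsW₁,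
    padicValNat_finset_prod₃ 2 s _ fun v _ ↦ ?_, padicValNat_finset_prod₃ 2 s _ fun v _ ↦ ?_]
  · refine Finset.sum_congr rfl fun v _ ↦ ?_
    haveI := Fact.mk (primesEquiv v).2
    exact padicValNat_two_localTamagawaNumber_twist_eq' W hd8 hS h₁ (primesEquiv v)
      (hℓ (primesEquiv v))
  · haveI := Fact.mk (primesEquiv v).2
    haveI : (W₁.baseChange ℚ_[primesEquiv v]).IsElliptic :=
      inferInstanceAs (W₁.map (algebraMap ℚ ℚ_[primesEquiv v])).IsElliptic
    exact localTamagawaNumber_padic_ne_zero_holds (primesEquiv v) _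
  · haveI := Fact.mk (primesEquiv v).2
    haveI : (W.baseChange ℚ_[primesEquiv v]).IsElliptic :=
      inferInstanceAs (W.map (algebraMap ℚ ℚ_[primesEquiv v])).IsElliptic
    exact localTamagawaNumber_padic_ne_zero_holds (primesEquiv v) _

end Summit.BirchSwinnertonDyer.Uniform.U2

end
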